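import Summits.BirchSwinnertonDyer.BirchSwinnertonDyer.Theorems.CMKolyvaginAtInertTwoCMKolyvaginConjectureAtInertTwoPositiveDepthGenusTrace
import Summits.BirchSwinnertonDyer.BirchSwinnertonDyer.Theorems.CMKolyvaginAtInertTwoCMKolyvaginConjectureAtInertTwoPositiveDepthDatumFree
import Summits.BirchSwinnertonDyer.BirchSwinnertonDyer.Theorems.GenusKolyvaginAtTwoGenusPrimitiveSupplyAtTwoRingClassProduct
import HarnessLib

/-!
# Crux `CMKolyvaginConjectureAtInertTwo` (stmt-BirchSwinnertonDyer-24648), open stub `stub_positiveDepth`: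
# AT EVERY SQUARE-FREE CM-INERT KOLYVAGIN LEVEL, `P(n) mod 2E(K[n])` DOES NOT DEPEND ON THE KOLYVAGIN DATUM

Route `CMKolyvaginAtInertTwo` (cell `pub/bsd-eis`, seat `leafhand-bsd-cmkolyvaginatinert-2` g0); helper (`--supports
stmt-BirchSwinnertonDyer-24648 --as helper`). THEOREMS ONLY (no definition, no named fact, no `sorry`); closes nothing;
BSD is proved for no curve. Sequel of `…PositiveDepthDatumFree.lean` (p796080, PRIME level only) and
`…PositiveDepthGenusTrace.lean` (p795141, genus-trace form at every level).

WHAT. The stub quantifies `∃ (n) (d : KolyvaginHeegnerData Dt β ι n)`: the datum CHOOSES the generators `σ_ℓ` of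
`G_ℓ = Gal(K[n]/K[n/ℓ])` (any of the `φ(ℓ+1)` generators) and the transversal `S` of `G_n = Gal(K[n]/K[1])` in
`𝒢_n = Gal(K[n]/K)`; `y(n)` is pinned by `map_y`. p796080 proved datum-independence of «`P(ℓ) ∈ 2E(K[ℓ])`» at a PRIME
level. This file proves it at EVERY square-free level `n` whose prime factors are Zhang–Kolyvagin primes at `2` inert in
the CM field, on a frame of the stub (CM, odd `d_K ≠ −3`, Heegner for `N_E`):

* §1 (pure algebra) `foldr_normPart_eq_of_zpowers_eq` — the genus norm `𝒩_L = ∏_{q∈L} Σ_{k<(q+1)/2} σ_q^{2k}` depends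
  only on the subgroups `⟨σ_q⟩` (through `⟨σ_q²⟩`); `map_σ_foldr_normPart_eq_neg` — `σ_ℓ 𝒩_L y = −𝒩_L y` for `ℓ ∈ L`
  when the `σ`'s commute and `Tr_ℓ y = 0`; `eq_or_eq_neg_of_mem_foldr_span` — every product `∏ σ_ℓ^{i_ℓ}` then acts on
  `𝒩_L y` by `±1`; `two_dvd_sum_transversal_iff_of_subgroup` — two transversals of `𝒢/H` give sums `Σ_s s(a)` that
  agree modulo `2` as soon as `a mod 2` is `H`-fixed (Gross 1991 §4: *"[P_n] is independent of the choice of S"*).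
* §2 `genusNorm_eq_of_data` — two data `d, d'` of the same conductor have the SAME genus norm `𝒩_n y(n) ∈ E(K[n])`
  (`orderOf σ_q = q + 1` = tree `X11b.RingClassTower.orderOf_eq_succ_of_zpowers_eq_ringClassGalOver`);
  `pointGalHom_genusNorm_eq_or_eq_neg` — EVERY `g ∈ G_n` acts on `𝒩_n y(n)` by `±1` (`G_n = ∏ G_ℓ` = tree
  `GenusKoly.mem_foldr_span_of_mem_ringClassGalOver_one`; partial traces vanish, p795141);
  **`two_dvd_derivedPoint_iff_of_data_of_squarefree`** — `P_d(n) ∈ 2E(K[n]) ⟺ P_{d'}(n) ∈ 2E(K[n])` for ANY two data;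
  `exists_iff_forall_primitive_of_squarefree` — the stub's `∃ d` reads `∀ d` at every level;
  `conclusion_iff_forall_data` — the conclusion of `stub_positiveDepth` ∕ crux 24648 in CANONICAL form («some admissible
  `n` at which EVERY datum has `P(n) ∉ 2E(K[n])`»).

HONEST FRAMING: group bookkeeping over tree theorems; the open mathematics (Kolyvagin's non-vanishing at `2` on H₂, i.e. a
`2`-primitive genus trace at some CM-inert Kolyvagin level) is untouched; no stub is closed; BSD is proved for no curve.
[cite: GrossLMS1991, §3 (G_n = ∏ G_ℓ, (3.5)), §4 (4.1) and the remark after (4.1)] [cite: WZhang2014, §3.7]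
-/

set_option linter.dupNamespace false -- `Summit.BirchSwinnertonDyer.BirchSwinnertonDyer.Theorems.…` (summit = sub)
set_option autoImplicit false

noncomputable section

open scoped Classical

namespace Summit.BirchSwinnertonDyer.BirchSwinnertonDyer.Theorems.CMKolyvaginConjecturePositiveDepth

open Finset

/-! ## §1 Algebra: a group acting on an additive group -/

section Algebra

variable {G : Type*} [Group G] {A : Type*} [AddCommGroup A] (ρ : G →* AddMonoid.End A)

/-- **The genus norm depends only on the subgroups `⟨σ_q⟩`.** Two systems `σ, σ'` with `orderOf σ_q = orderOf σ'_q =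
q + 1` (`q ∈ L` odd) and `⟨σ'_q⟩ = ⟨σ_q⟩` have the same norm-part operator
`∏_{q∈L} Σ_{k<(q+1)/2} σ_q^{2k}` on every `y` (each factor is the sum over the squares of `⟨σ_q⟩`). [folklore] -/
theorem foldr_normPart_eq_of_zpowers_eq (σ σ' : ℕ → G) (L : List ℕ)
    (hord : ∀ q ∈ L, orderOf (σ q) = q + 1) (hord' : ∀ q ∈ L, orderOf (σ' q) = q + 1)
    (hodd : ∀ q ∈ L, Odd q) (hz : ∀ q ∈ L, Subgroup.zpowers (σ' q) = Subgroup.zpowers (σ q)) (y : A) :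
    L.foldr (fun q x ↦ ∑ k ∈ range ((q + 1) / 2), ρ ((σ' q ^ 2) ^ k) x) y =
      L.foldr (fun q x ↦ ∑ k ∈ range ((q + 1) / 2), ρ ((σ q ^ 2) ^ k) x) y := by
  induction L with
  | nil => rfl
  | cons q L ih =>
    simp only [List.foldr_cons]
    rw [ih (fun q' h ↦ hord q' (List.mem_cons_of_mem q h)) (fun q' h ↦ hord' q' (List.mem_cons_of_mem q h))
      (fun q' h ↦ hodd q' (List.mem_cons_of_mem q h)) (fun q' h ↦ hz q' (List.mem_cons_of_mem q h))]
    obtain ⟨h, hh⟩ : ∃ h, q + 1 = 2 * h := by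
      obtain ⟨r, hr⟩ := hodd q List.mem_cons_self
      exact ⟨r + 1, by omega⟩
    have hdiv : (q + 1) / 2 = h := by omega
    rw [hdiv]
    exact halfTrace_eq_of_zpowers_eq ρ (σ q) (σ' q) (by omega) (hh ▸ hord q List.mem_cons_self)
      (hh ▸ hord' q List.mem_cons_self) (hz q List.mem_cons_self) _

/-- **`σ_ℓ 𝒩_L y = −𝒩_L y`** for `ℓ ∈ L`, when `σ_ℓ` commutes with every `σ_q` (`q ∈ L`), `ℓ` is odd and the
`ℓ`-trace `Σ_{i≤ℓ} σ_ℓ^i y` vanishes: the factor `N_ℓ = Σ_{k<(ℓ+1)/2} σ_ℓ^{2k}` of `𝒩_L` satisfies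
`σ_ℓ N_ℓ z = −N_ℓ z` whenever `Tr_ℓ z = 0` (p795141 `map_normPart_eq_neg_of_trace_eq_zero`), and the other factors
commute with `σ_ℓ`. [folklore] -/
theorem map_σ_foldr_normPart_eq_neg (σ : ℕ → G) (ℓ : ℕ) (hℓ : Odd ℓ) (L : List ℕ) (hℓL : ℓ ∈ L)
    (hcomm : ∀ q ∈ L, Commute (σ ℓ) (σ q)) (y : A) (htr : ∑ i ∈ range (ℓ + 1), ρ (σ ℓ ^ i) y = 0) :
    ρ (σ ℓ) (L.foldr (fun q x ↦ ∑ k ∈ range ((q + 1) / 2), ρ ((σ q ^ 2) ^ k) x) y) =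
      -L.foldr (fun q x ↦ ∑ k ∈ range ((q + 1) / 2), ρ ((σ q ^ 2) ^ k) x) y := by
  induction L with
  | nil => simp at hℓL
  | cons q L ih =>
    have hcommL : ∀ q' ∈ L, Commute (σ ℓ) (σ q') := fun q' h ↦ hcomm q' (List.mem_cons_of_mem q h)
    simp only [List.foldr_cons]
    set z := L.foldr (fun q x ↦ ∑ k ∈ range ((q + 1) / 2), ρ ((σ q ^ 2) ^ k) x) y with hz
    by_cases hq : q = ℓ
    · subst hq
      have hzq : ∑ i ∈ range (q + 1), ρ (σ q ^ i) z = 0 := by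
        rw [hz, sum_pow_foldr_normPart_comm ρ σ q (range (q + 1)) L hcommL y, htr, foldr_normPart_zero]
      exact map_normPart_eq_neg_of_trace_eq_zero ρ (σ q) hℓ z hzq
    · have hℓL' : ℓ ∈ L := by
        rcases List.mem_cons.mp hℓL with h | h
        · exact absurd h.symm hq
        · exact h
      have hc : ∀ k : ℕ, ρ (σ ℓ) (ρ ((σ q ^ 2) ^ k) z) = ρ ((σ q ^ 2) ^ k) (ρ (σ ℓ) z) := fun k ↦ by
        have h := (((hcomm q List.mem_cons_self).pow_right 2).pow_right k).eq
        have h' := congrArg (fun g ↦ ρ g z) h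
        simp only [map_mul] at h'
        exact h'
      rw [map_sum, ← Finset.sum_neg_distrib]
      refine Finset.sum_congr rfl fun k _ ↦ ?_
      rw [hc k, ih hℓL' hcommL, map_neg]

/-- **Every product `∏_{ℓ∈L} σ_ℓ^{i_ℓ}` (`0 ≤ i_ℓ ≤ ℓ`) acts on `a` by `±1` when each `σ_ℓ` acts on `a` by `−1`.**
The products are listed by the multi-index span `L.foldr (fun ℓ T ↦ (range (ℓ+1) ×ˢ T).image (σ_ℓ^i · t)) {1}` of
`GenusKoly.mem_foldr_span_of_mem_ringClassGalOver_one`. [folklore] -/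
theorem eq_or_eq_neg_of_mem_foldr_span (σ : ℕ → G) (a : A) (L : List ℕ) (hneg : ∀ ℓ ∈ L, ρ (σ ℓ) a = -a) :
    ∀ g ∈ L.foldr (fun ℓ T ↦ (range (ℓ + 1) ×ˢ T).image (fun p ↦ σ ℓ ^ p.1 * p.2)) ({1} : Finset G),
      ρ g a = a ∨ ρ g a = -a := by
  induction L with
  | nil =>
    intro g hg
    simp only [List.foldr_nil, Finset.mem_singleton] at hg
    rw [hg, map_one]
    exact Or.inl rfl
  | cons ℓ L ih =>
    intro g hg
    simp only [List.foldr_cons, Finset.mem_image, Finset.mem_product, Finset.mem_range, Prod.exists] at hg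
    obtain ⟨i, g', ⟨-, hg'⟩, rfl⟩ := hg
    have hL : ∀ ℓ' ∈ L, ρ (σ ℓ') a = -a := fun ℓ' h ↦ hneg ℓ' (List.mem_cons_of_mem ℓ h)
    have hi : ρ (σ ℓ ^ i) a = ((-1 : ℤ) ^ i) • a :=
      pow_smul_eq_neg_one_pow_of_eq_neg ρ (σ ℓ) a (hneg ℓ List.mem_cons_self) i
    rw [map_mul]
    change ρ (σ ℓ ^ i) (ρ g' a) = a ∨ ρ (σ ℓ ^ i) (ρ g' a) = -a
    rcases ih hL g' hg' with h | h
    · rw [h, hi]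
      rcases neg_one_pow_eq_or ℤ i with h1 | h1
      · exact Or.inl (by rw [h1, one_smul])
      · exact Or.inr (by rw [h1, neg_one_smul])
    · rw [h, map_neg, hi]
      rcases neg_one_pow_eq_or ℤ i with h1 | h1
      · exact Or.inr (by rw [h1, one_smul])
      · exact Or.inl (by rw [h1, neg_one_smul, neg_neg])

/-- **Two transversals give the same sum modulo `2`** (general subgroup): let `H ≤ G`, `𝒢 ≤ G`, and `a ∈ A` whose
class modulo `2A` is `H`-fixed (`h a − a ∈ 2A` for `h ∈ H`); if `S, S' ⊆ 𝒢` are both systems of representatives of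
`𝒢/H` (`∀ g ∈ 𝒢, ∃! s ∈ S, g⁻¹ s ∈ H`), then `Σ_{s∈S} s(a) ∈ 2A ⟺ Σ_{s'∈S'} s'(a) ∈ 2A`. (p796080's
`two_dvd_sum_transversal_iff` is the case `H = ⟨σ⟩`, `σa = −a`.)
[cite: GrossLMS1991, §4 (remark after (4.1): [P_n] is independent of S)] -/
theorem two_dvd_sum_transversal_iff_of_subgroup (𝒢 H : Subgroup G) (a : A)
    (ha : ∀ h ∈ H, ∃ t : A, ρ h a - a = (2 : ℤ) • t)
    (S S' : Finset G) (hS : ∀ s ∈ S, s ∈ 𝒢) (hS' : ∀ s ∈ S', s ∈ 𝒢)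
    (hT : ∀ g ∈ 𝒢, ∃! s, s ∈ S ∧ g⁻¹ * s ∈ H)
    (hT' : ∀ g ∈ 𝒢, ∃! s, s ∈ S' ∧ g⁻¹ * s ∈ H) :
    (∃ Q : A, (2 : ℤ) • Q = ∑ s ∈ S, ρ s a) ↔ ∃ Q : A, (2 : ℤ) • Q = ∑ s ∈ S', ρ s a := by
  -- the matching `φ : S' → S`, `ψ : S → S'`
  have hex : ∀ s' ∈ S', ∃ s, s ∈ S ∧ s'⁻¹ * s ∈ H := fun s' hs' ↦ (hT s' (hS' s' hs')).exists
  have hex' : ∀ s ∈ S, ∃ s', s' ∈ S' ∧ s⁻¹ * s' ∈ H := fun s hs ↦ (hT' s (hS s hs)).exists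
  choose! φ hφS hφH using hex
  choose! ψ hψS hψH using hex'
  have hH : ∀ {x y z : G}, x⁻¹ * y ∈ H → y⁻¹ * z ∈ H → x⁻¹ * z ∈ H := fun {x y z} h1 h2 ↦ by
    have := H.mul_mem h1 h2
    rwa [mul_assoc, mul_inv_cancel_left] at this
  have hψφ : ∀ s' ∈ S', ψ (φ s') = s' := fun s' hs' ↦ by
    have h1 : s'⁻¹ * ψ (φ s') ∈ H := hH (hφH s' hs') (hψH _ (hφS s' hs'))
    have h2 : s'⁻¹ * s' ∈ H := by rw [inv_mul_cancel]; exact H.one_mem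
    exact (hT' s' (hS' s' hs')).unique ⟨hψS _ (hφS s' hs'), h1⟩ ⟨hs', h2⟩
  have hφψ : ∀ s ∈ S, φ (ψ s) = s := fun s hs ↦ by
    have h1 : s⁻¹ * φ (ψ s) ∈ H := hH (hψH s hs) (hφH _ (hψS s hs))
    have h2 : s⁻¹ * s ∈ H := by rw [inv_mul_cancel]; exact H.one_mem
    exact (hT s (hS s hs)).unique ⟨hφS _ (hψS s hs), h1⟩ ⟨hs, h2⟩
  -- reindex the `S`-sum along `φ`
  have hre : ∑ s ∈ S, ρ s a = ∑ s' ∈ S', ρ (φ s') a :=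
    (Finset.sum_nbij' φ ψ hφS hψS hψφ hφψ (fun _ _ ↦ rfl)).symm
  -- each `φ s' = s' h` acts on `a` as `s'` modulo `2`
  have hterm : ∀ s' ∈ S', ∃ t : A, ρ (φ s') a - ρ s' a = (2 : ℤ) • t := fun s' hs' ↦ by
    obtain ⟨t, ht⟩ := ha _ (hφH s' hs')
    refine ⟨ρ s' t, ?_⟩
    have hφeq : φ s' = s' * (s'⁻¹ * φ s') := by rw [mul_inv_cancel_left]
    rw [hφeq, map_mul]
    change ρ s' (ρ (s'⁻¹ * φ s') a) - ρ s' a = _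
    rw [← map_sub, ht, map_zsmul]
  choose! t ht using hterm
  have hdiff : ∑ s ∈ S, ρ s a = ∑ s' ∈ S', ρ s' a + (2 : ℤ) • ∑ s' ∈ S', t s' := by
    rw [hre, Finset.smul_sum, ← Finset.sum_add_distrib]
    exact Finset.sum_congr rfl fun s' hs' ↦ by rw [← ht s' hs']; abel
  constructor
  · rintro ⟨Q, hQ⟩
    exact ⟨Q - ∑ s' ∈ S', t s', by rw [smul_sub, hQ, hdiff]; abel⟩
  · rintro ⟨Q, hQ⟩
    exact ⟨Q + ∑ s' ∈ S', t s', by rw [smul_add, hQ, hdiff]⟩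

end Algebra

/-! ## §2 Heegner data: the genus norm and the derived point modulo `2` are canonical -/

section Heegner

open WeierstrassCurve NumberField Literature.NumberTheory.EllipticCurves
  Literature.NumberTheory.EllipticCurves.ModularForms Literature.NumberTheory.EllipticCurves.Rank1Residual
  Summit.BirchSwinnertonDyer.BirchSwinnertonDyer.Theorems

variable {K : Type} [Field K] [NumberField K]

/-- `d_K < −4` for an imaginary quadratic field of odd discriminant `≠ −3`. [folklore] -/
private theorem discr_lt_neg_four_of_odd (hK : IsImaginaryQuadratic K) (hodd : Odd (NumberField.discr K))
    (h3 : NumberField.discr K ≠ -3) : NumberField.discr K < -4 := by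
  have hgt : 2 < |NumberField.discr K| := NumberField.abs_discr_gt_two (by rw [hK.1]; exact one_lt_two)
  have hneg : NumberField.discr K < 0 := hK.discr_neg
  rw [abs_of_neg hneg] at hgt
  obtain ⟨r, hr⟩ := hodd
  omega

/-- **`orderOf σ_q = q + 1`** for the generator `σ_q` of a datum of square-free conductor `n` at a prime factor `q` inert in
`K` (odd `d_K ≠ −3`): `⟨σ_q⟩ = G_q = Gal(K[n]/K[n/q])` has order `q + 1` (tree
`X11b.RingClassTower.orderOf_eq_succ_of_zpowers_eq_ringClassGalOver`). [cite: GrossLMS1991, §3 (G_ℓ cyclic of order ℓ+1)] -/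
theorem orderOf_σ_eq_succ_of_mem_primeFactors (W : WeierstrassCurve ℚ) {N : ℕ} [NeZero N]
    (hK : IsImaginaryQuadratic K) (hodd : Odd (NumberField.discr K)) (h3 : NumberField.discr K ≠ -3)
    {Dt : ModularParametrizationData W N} {β : ℤ} {ι : K →+* ℂ} {n : ℕ} (hn : Squarefree n)
    (d : KolyvaginHeegnerData Dt β ι n) {q : ℕ} (hq : q ∈ n.primeFactors)
    (hinert : (Ideal.span {(q : 𝓞 K)}).IsPrime) : orderOf (d.σ q) = q + 1 := by
  have hqp : q.Prime := Nat.prime_of_mem_primeFactors hq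
  have hqdvd : q ∣ n := Nat.dvd_of_mem_primeFactors hq
  have hqm : ¬ q ∣ n / q := fun h ↦ by
    have h2 : q * q ∣ n := by
      rw [← Nat.mul_div_cancel' hqdvd]
      exact Nat.mul_dvd_mul_left q h
    exact hqp.one_lt.ne' (Nat.isUnit_iff.mp (hn q h2))
  exact _root_.Summit.BirchSwinnertonDyer.Rank1Residual.X11b.RingClassTower.orderOf_eq_succ_of_zpowers_eq_ringClassGalOver
    hK ι hqp hinert hqdvd hqm hn.ne_zero (Or.inr (discr_lt_neg_four_of_odd hK hodd h3)) (d.zpowers_σ q hq)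

/-- **The genus norm `𝒩_n y(n) ∈ E(K[n])` is the same for all data of conductor `n`.** For `W/ℚ` globally minimal,
`K` imaginary quadratic with odd `d_K ≠ −3`, `n` square-free with all prime factors Zhang–Kolyvagin primes at `2`, and two
data `d, d'` of conductor `n` on the frame `(Dt, β, ι)`: `𝒩_{n,d'} y_{d'}(n) = 𝒩_{n,d} y_d(n)`, where
`𝒩_{n,d} = ∏_{ℓ ∣ n} Σ_{k<(ℓ+1)/2} σ_ℓ^{2k}` along `n.primeFactorsList` (`y(n)` is pinned by `map_y`; each factor sees
only `⟨σ_ℓ²⟩`). [cite: GrossLMS1991, §3 (3.5), §4 (4.1)] [cite: WZhang2014, §3.7] -/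
theorem genusNorm_eq_of_data (W : WeierstrassCurve ℚ) [W.IsElliptic] [W.IsGloballyMinimal]
    [NeZero (W.conductorNorm ℤ)] (hK : IsImaginaryQuadratic K)
    (hodd : Odd (NumberField.discr K)) (h3 : NumberField.discr K ≠ -3)
    {Dt : ModularParametrizationData W (W.conductorNorm ℤ)} {β : ℤ} {ι : K →+* ℂ} {n : ℕ} (hn : Squarefree n)
    (hKol : ∀ ℓ ∈ n.primeFactors, Zhang2014.IsKolyvaginPrime (W.conductorNorm ℤ) W K 2 ℓ)
    (d d' : KolyvaginHeegnerData Dt β ι n) :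
    n.primeFactorsList.foldr
        (fun ℓ x ↦ ∑ k ∈ range ((ℓ + 1) / 2), pointGalHom W (ringClassField K ι n) ((d'.σ ℓ ^ 2) ^ k) x) d'.y =
      n.primeFactorsList.foldr
        (fun ℓ x ↦ ∑ k ∈ range ((ℓ + 1) / 2), pointGalHom W (ringClassField K ι n) ((d.σ ℓ ^ 2) ^ k) x) d.y := by
  have hy : d'.y = d.y :=
    Affine.Point.map_injective (W' := W) (ringClassField K ι n).subtype.toRatAlgHom (d'.map_y.trans d.map_y.symm)
  have hmem : ∀ q ∈ n.primeFactorsList, q ∈ n.primeFactors := fun q hq ↦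
    Nat.mem_primeFactors_iff_mem_primeFactorsList.mpr hq
  rw [hy]
  exact foldr_normPart_eq_of_zpowers_eq (pointGalHom W (ringClassField K ι n)) d.σ d'.σ n.primeFactorsList
    (fun q hq ↦ orderOf_σ_eq_succ_of_mem_primeFactors W hK hodd h3 hn d (hmem q hq) (hKol q (hmem q hq)).2.2.2.2.1)
    (fun q hq ↦ orderOf_σ_eq_succ_of_mem_primeFactors W hK hodd h3 hn d' (hmem q hq) (hKol q (hmem q hq)).2.2.2.2.1)
    (fun q hq ↦ (hKol q (hmem q hq)).1.odd_of_ne_two (hKol q (hmem q hq)).2.2.2.1)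
    (fun q hq ↦ by rw [d.zpowers_σ q (hmem q hq), d'.zpowers_σ q (hmem q hq)]) d.y

/-- **Every `g ∈ G_n = Gal(K[n]/K[1])` acts on the genus norm `𝒩_n y(n)` by `±1`.** On a frame of the stub (`W/ℚ`
globally minimal with CM, `K` imaginary quadratic with odd `d_K ≠ −3` and Heegner for `N_E`), at a square-free level `n`
whose prime factors are Zhang–Kolyvagin primes at `2` inert in `F`: `G_n = ∏_{ℓ∣n} G_ℓ` (tree
`GenusKoly.mem_foldr_span_of_mem_ringClassGalOver_one`: `g = ∏ σ_ℓ^{i_ℓ}`) and each `σ_ℓ` acts on `𝒩_n y(n)` by `−1`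
(every partial trace `Tr_ℓ y(n) = a_ℓ y(n/ℓ) = 0` vanishes, p795141). [cite: GrossLMS1991, §3 (G_n = ∏ G_ℓ), Prop. 3.7 (1)] -/
theorem pointGalHom_genusNorm_eq_or_eq_neg (W : WeierstrassCurve ℚ) [W.IsElliptic] [W.IsGloballyMinimal]
    [NeZero (W.conductorNorm ℤ)] (hCM : W.HasCM) (hK : IsImaginaryQuadratic K)
    (hodd : Odd (NumberField.discr K)) (h3 : NumberField.discr K ≠ -3)
    (hH : SatisfiesHeegnerHypothesis (W.conductorNorm ℤ) K)
    {Dt : ModularParametrizationData W (W.conductorNorm ℤ)} {β : ℤ} {ι : K →+* ℂ} {n : ℕ} (hn : Squarefree n)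
    (hKol : ∀ ℓ ∈ n.primeFactors, Zhang2014.IsKolyvaginPrime (W.conductorNorm ℤ) W K 2 ℓ ∧ CMInert W ℓ)
    (d : KolyvaginHeegnerData Dt β ι n) {g : ringClassField K ι n ≃ₐ[ℚ] ringClassField K ι n}
    (hg : g ∈ ringClassGalOver ι n 1) :
    pointGalHom W (ringClassField K ι n) g (n.primeFactorsList.foldr
        (fun ℓ x ↦ ∑ k ∈ range ((ℓ + 1) / 2), pointGalHom W (ringClassField K ι n) ((d.σ ℓ ^ 2) ^ k) x) d.y) =
      n.primeFactorsList.foldr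
        (fun ℓ x ↦ ∑ k ∈ range ((ℓ + 1) / 2), pointGalHom W (ringClassField K ι n) ((d.σ ℓ ^ 2) ^ k) x) d.y ∨
    pointGalHom W (ringClassField K ι n) g (n.primeFactorsList.foldr
        (fun ℓ x ↦ ∑ k ∈ range ((ℓ + 1) / 2), pointGalHom W (ringClassField K ι n) ((d.σ ℓ ^ 2) ^ k) x) d.y) =
      -n.primeFactorsList.foldr
        (fun ℓ x ↦ ∑ k ∈ range ((ℓ + 1) / 2), pointGalHom W (ringClassField K ι n) ((d.σ ℓ ^ 2) ^ k) x) d.y := by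
  have hD := discr_lt_neg_four_of_odd hK hodd h3
  have hmem : ∀ q ∈ n.primeFactorsList, q ∈ n.primeFactors := fun q hq ↦
    Nat.mem_primeFactors_iff_mem_primeFactorsList.mpr hq
  have hspan := GenusKoly.mem_foldr_span_of_mem_ringClassGalOver_one hK ι hD hn
    (fun ℓ hℓ ↦ (hKol ℓ hℓ).1.2.2.2.2.1) d.zpowers_σ hg
  refine eq_or_eq_neg_of_mem_foldr_span (pointGalHom W (ringClassField K ι n)) d.σ _ n.primeFactorsList
    (fun ℓ hℓ ↦ ?_) g hspan
  have hℓ' := hmem ℓ hℓ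
  exact map_σ_foldr_normPart_eq_neg (pointGalHom W (ringClassField K ι n)) d.σ ℓ
    ((hKol ℓ hℓ').1.1.odd_of_ne_two (hKol ℓ hℓ').1.2.2.2.1) n.primeFactorsList hℓ
    (fun q hq ↦ commute_σ_of_mem_primeFactors W hK hn.ne_zero d hℓ' (hmem q hq)) d.y
    (sum_range_pointGalHom_σ_pow_y_eq_zero_of_mem_primeFactors W hCM hK hodd h3 hH hn hKol d hℓ')

/-- **The `2`-divisibility of the genus trace does not depend on the datum.** Same frame; for two data `d, d'` of the
same square-free CM-inert Kolyvagin conductor `n`: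
`Σ_{s∈S_d} s(𝒩_{n,d} y(n)) ∈ 2E(K[n]) ⟺ Σ_{s∈S_{d'}} s(𝒩_{n,d'} y(n)) ∈ 2E(K[n])` (same genus norm; the two
transversals of `𝒢_n/G_n` are matched through `G_n`, which acts on the genus norm by `±1`).
[cite: GrossLMS1991, §4 (4.1) and the remark that [P_n] is independent of S] -/
theorem two_dvd_genusTrace_iff_of_data (W : WeierstrassCurve ℚ) [W.IsElliptic] [W.IsGloballyMinimal]
    [NeZero (W.conductorNorm ℤ)] (hCM : W.HasCM) (hK : IsImaginaryQuadratic K)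
    (hodd : Odd (NumberField.discr K)) (h3 : NumberField.discr K ≠ -3)
    (hH : SatisfiesHeegnerHypothesis (W.conductorNorm ℤ) K)
    {Dt : ModularParametrizationData W (W.conductorNorm ℤ)} {β : ℤ} {ι : K →+* ℂ} {n : ℕ} (hn : Squarefree n)
    (hKol : ∀ ℓ ∈ n.primeFactors, Zhang2014.IsKolyvaginPrime (W.conductorNorm ℤ) W K 2 ℓ ∧ CMInert W ℓ)
    (d d' : KolyvaginHeegnerData Dt β ι n) :
    (∃ Q : (W.baseChange (ringClassField K ι n)).toAffine.Point, (2 : ℤ) • Q =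
        ∑ s ∈ d.S, pointGalHom W (ringClassField K ι n) s
          (n.primeFactorsList.foldr
            (fun ℓ x ↦ ∑ k ∈ range ((ℓ + 1) / 2), pointGalHom W (ringClassField K ι n) ((d.σ ℓ ^ 2) ^ k) x) d.y)) ↔
      ∃ Q : (W.baseChange (ringClassField K ι n)).toAffine.Point, (2 : ℤ) • Q =
        ∑ s ∈ d'.S, pointGalHom W (ringClassField K ι n) s
          (n.primeFactorsList.foldr
            (fun ℓ x ↦ ∑ k ∈ range ((ℓ + 1) / 2), pointGalHom W (ringClassField K ι n) ((d'.σ ℓ ^ 2) ^ k) x) d'.y) := by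
  rw [genusNorm_eq_of_data W hK hodd h3 hn (fun ℓ hℓ ↦ (hKol ℓ hℓ).1) d d']
  refine two_dvd_sum_transversal_iff_of_subgroup (pointGalHom W (ringClassField K ι n)) (ringClassGal ι n)
    (ringClassGalOver ι n 1) _ (fun h hh ↦ ?_) d.S d'.S d.S_subset d'.S_subset d.S_transversal d'.S_transversal
  rcases pointGalHom_genusNorm_eq_or_eq_neg W hCM hK hodd h3 hH hn hKol d hh with h1 | h1
  · exact ⟨0, by rw [h1, sub_self, smul_zero]⟩
  · exact ⟨-n.primeFactorsList.foldr
        (fun ℓ x ↦ ∑ k ∈ range ((ℓ + 1) / 2), pointGalHom W (ringClassField K ι n) ((d.σ ℓ ^ 2) ^ k) x) d.y,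
      by rw [h1]; abel⟩

/-- **At every square-free CM-inert Kolyvagin level, the `2`-divisibility of `P(n)` does not depend on the Kolyvagin
datum.** For `W/ℚ` globally minimal with CM, `K` imaginary quadratic with odd `d_K ≠ −3` and Heegner for `N_E`, `n`
square-free all of whose prime factors are Zhang–Kolyvagin primes at `2` inert in `F`, and ANY two data `d, d'` of
conductor `n` on the frame `(Dt, β, ι)`: **`P_d(n) ∈ 2E(K[n]) ⟺ P_{d'}(n) ∈ 2E(K[n])`** (p795141's genus-trace form on
both sides + `two_dvd_genusTrace_iff_of_data`). p796080's `two_dvd_derivedPoint_iff_of_data` is the prime-level case.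
[cite: GrossLMS1991, §3 (3.5), Prop. 3.7 (1), §4 (4.1) and the remark that [P_n] is independent of S] [cite: WZhang2014, §3.7] -/
theorem two_dvd_derivedPoint_iff_of_data_of_squarefree (W : WeierstrassCurve ℚ) [W.IsElliptic] [W.IsGloballyMinimal]
    [NeZero (W.conductorNorm ℤ)] (hCM : W.HasCM) (hK : IsImaginaryQuadratic K)
    (hodd : Odd (NumberField.discr K)) (h3 : NumberField.discr K ≠ -3)
    (hH : SatisfiesHeegnerHypothesis (W.conductorNorm ℤ) K)
    {Dt : ModularParametrizationData W (W.conductorNorm ℤ)} {β : ℤ} {ι : K →+* ℂ} {n : ℕ} (hn : Squarefree n)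
    (hKol : ∀ ℓ ∈ n.primeFactors, Zhang2014.IsKolyvaginPrime (W.conductorNorm ℤ) W K 2 ℓ ∧ CMInert W ℓ)
    (d d' : KolyvaginHeegnerData Dt β ι n) :
    (∃ Q : (W.baseChange (ringClassField K ι n)).toAffine.Point, (2 : ℤ) • Q = d.derivedPoint) ↔
      ∃ Q : (W.baseChange (ringClassField K ι n)).toAffine.Point, (2 : ℤ) • Q = d'.derivedPoint := by
  rw [two_dvd_derivedPoint_iff_two_dvd_genusTrace W hCM hK hodd h3 hH hn hKol d,
    two_dvd_derivedPoint_iff_two_dvd_genusTrace W hCM hK hodd h3 hH hn hKol d']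
  exact two_dvd_genusTrace_iff_of_data W hCM hK hodd h3 hH hn hKol d d'

/-- **At every admissible level the stub's `∃ d` may be read `∀ d`.** Same frame, any conductor-`1` datum `d₁` (so that
data of conductor `n` exist, p794939 `nonempty_kolyvaginHeegnerData_of_kolyvaginPrimes`), `n` square-free with CM-inert
Zhang–Kolyvagin prime factors: `(∃ d, P_d(n) ∉ 2E(K[n])) ⟺ (∀ d, P_d(n) ∉ 2E(K[n]))`. [cite: GrossLMS1991, §4 (4.1)] -/
theorem exists_iff_forall_primitive_of_squarefree (W : WeierstrassCurve ℚ) [W.IsElliptic] [W.IsGloballyMinimal]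
    [NeZero (W.conductorNorm ℤ)] (hCM : W.HasCM) (hK : IsImaginaryQuadratic K)
    (hodd : Odd (NumberField.discr K)) (h3 : NumberField.discr K ≠ -3)
    (hH : SatisfiesHeegnerHypothesis (W.conductorNorm ℤ) K)
    {Dt : ModularParametrizationData W (W.conductorNorm ℤ)} {β : ℤ} {ι : K →+* ℂ}
    (d₁ : KolyvaginHeegnerData Dt β ι 1) {n : ℕ} (hn : Squarefree n)
    (hKol : ∀ ℓ ∈ n.primeFactors, Zhang2014.IsKolyvaginPrime (W.conductorNorm ℤ) W K 2 ℓ ∧ CMInert W ℓ) :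
    (∃ d : KolyvaginHeegnerData Dt β ι n,
        ¬ ∃ Q : (W.baseChange (ringClassField K ι n)).toAffine.Point, (2 : ℤ) • Q = d.derivedPoint) ↔
      ∀ d : KolyvaginHeegnerData Dt β ι n,
        ¬ ∃ Q : (W.baseChange (ringClassField K ι n)).toAffine.Point, (2 : ℤ) • Q = d.derivedPoint := by
  refine ⟨fun ⟨d, hd⟩ d' h' ↦
    hd ((two_dvd_derivedPoint_iff_of_data_of_squarefree W hCM hK hodd h3 hH hn hKol d' d).mp h'), fun h ↦ ?_⟩
  obtain ⟨d⟩ := nonempty_kolyvaginHeegnerData_of_kolyvaginPrimes W hK hH Dt ι d₁ hn (fun q hq ↦ (hKol q hq).1)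
  exact ⟨d, h d⟩

/-- **The conclusion of `stub_positiveDepth` ∕ crux 24648 in CANONICAL form.** On a frame of the stub carrying a
conductor-`1` datum `d₁`: «some square-free product `n` of Zhang–Kolyvagin primes at `2` inert in `F` and SOME datum `d` of
conductor `n` have `P_d(n) ∉ 2E(K[n])`» ⟺ «some such `n` admits data and EVERY datum of conductor `n` has
`P(n) ∉ 2E(K[n])`» — the witness level `n` is a property of the frame, not of the choices `(σ_ℓ, S)`.
[cite: GrossLMS1991, §4 (4.1) and the remark that [P_n] is independent of S] [cite: WZhang2014, §3.7 (c(n) for n ∈ Λ)] -/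
theorem conclusion_iff_forall_data (W : WeierstrassCurve ℚ) [W.IsElliptic] [W.IsGloballyMinimal]
    [NeZero (W.conductorNorm ℤ)] (hCM : W.HasCM) (hK : IsImaginaryQuadratic K)
    (hodd : Odd (NumberField.discr K)) (h3 : NumberField.discr K ≠ -3)
    (hH : SatisfiesHeegnerHypothesis (W.conductorNorm ℤ) K)
    {Dt : ModularParametrizationData W (W.conductorNorm ℤ)} {β : ℤ} {ι : K →+* ℂ}
    (d₁ : KolyvaginHeegnerData Dt β ι 1) :
    (∃ (n : ℕ) (d : KolyvaginHeegnerData Dt β ι n), Squarefree n ∧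
        (∀ ℓ ∈ n.primeFactors, Zhang2014.IsKolyvaginPrime (W.conductorNorm ℤ) W K 2 ℓ ∧ CMInert W ℓ) ∧
        ¬ ∃ Q : (W.baseChange (ringClassField K ι n)).toAffine.Point, (2 : ℤ) • Q = d.derivedPoint) ↔
      ∃ n : ℕ, Squarefree n ∧
        (∀ ℓ ∈ n.primeFactors, Zhang2014.IsKolyvaginPrime (W.conductorNorm ℤ) W K 2 ℓ ∧ CMInert W ℓ) ∧
        Nonempty (KolyvaginHeegnerData Dt β ι n) ∧
        ∀ d : KolyvaginHeegnerData Dt β ι n,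
          ¬ ∃ Q : (W.baseChange (ringClassField K ι n)).toAffine.Point, (2 : ℤ) • Q = d.derivedPoint := by
  constructor
  · rintro ⟨n, d, hn, hKol, hd⟩
    exact ⟨n, hn, hKol, ⟨d⟩,
      (exists_iff_forall_primitive_of_squarefree W hCM hK hodd h3 hH d₁ hn hKol).mp ⟨d, hd⟩⟩
  · rintro ⟨n, hn, hKol, ⟨d⟩, hall⟩
    exact ⟨n, d, hn, hKol, hall d⟩

end Heegner

end Summit.BirchSwinnertonDyer.BirchSwinnertonDyer.Theorems.CMKolyvaginConjecturePositiveDepth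

end
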